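import Literature.MathematicalPhysics.QuantumLattice.StabilityVolumeAssemblyProofs
import Literature.MathematicalPhysics.QuantumLattice.StabilityDecayCalculusProofs
import Literature.MathematicalPhysics.QuantumLattice.StabilityReductionProofs
import HarnessLib

/-!
# `michalakis_zwolak` from the spectral-flow core (uniform constants and final assembly)

Top-down layer (seat B) of the formalisation of the Michalakis–Zwolak stability theorem
(hubbard.S19, `Literature.MathematicalPhysics.QuantumLattice.michalakis_zwolak`), closing the
"algebraic half" of Michalakis–Zwolak, CMP **322** (2013) 277 = arXiv:1109.1588: everything in the
printed proof *after* the construction of the spectral flow and the quasi-locality estimates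
(Lemma 3, Lemma 4, Proposition 1, Proposition 2, §7) is now formal, and the named fact is reduced
to the following **spectral-flow core** (`michalakis_zwolak_of_coreA`, hypothesis `hA`; this is
the content of MZ13 Lemma 1 (iv)–(v), Lemma 2 and step 1 of Proposition 1, resting on
Bachmann–Michalakis–Nachtergaele–Sims' Lieb–Robinson bounds for the spectral flow):

> for the data of `michalakis_zwolak` there are `L_A` and a non-negative fast-decaying profile
> `φ` such that for `|ε| ≤ 1`, `L ≥ L_A`, `s ∈ [0, 1]`, whenever all `H₀ + tεV` (`t ≤ s`) have an
> `m L`-cluster of width `≤ γ` below a gap `γ/2`, there are a unitary `U` and terms `X u i`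
> (`u ∈ (ℤ/Lℤ)^d`, `i ≤ L`) with `U⋆ (H₀ + sεV) U = H₀ + Σ_u Σ_i X u i`, each `X u i` Hermitian
> and supported in `cellBall u i`, `[Σ_i X u i, P₀] = 0`, and `‖X u i‖ ≤ |ε| φ i`.

Contents:

* `localGroundProj_ne_zero_of_hasLocalGap` — under Local-Gap in a non-empty configuration
  space every `P_{b_u(r)}` is non-zero;
* the uniform constants (from `StabilityDecayCalculusProofs`): the Lemma 3 majorant
  `Σ_i φ i g_L(i) ≤ Gc/(L+1)^P` (`exists_lemma3_majorant`), tail and LTQO majorants, and the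
  bound `c_L ≤ c_*` on the relative-boundedness constant uniformly in `L`
  (`relative_constant_le`) — MZ13 p. 15 remark (ii): "for fast enough decay of `w(r)` … `c` is a
  constant depending only on the dimension `d` … and the decay rate of `γ(r_k)` and `w(r)`";
* `michalakis_zwolak_of_coreA` — via `exists_package_of_rotated_decomposition` (fixed volume)
  and `michalakis_zwolak_of_latticeCore`, with `ε₁ = min 1 (1/(3c_* + 3))` (`J₀ = 1/(3c)`,
  MZ13 §7) and `δ L = 2Gc/(L+1)` (`‖Δ_s‖ ≤ L^d max_u ‖Δ_u‖`).

No definitions, no named facts (theorems only).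
-/

noncomputable section

open Matrix Finset Module Filter
open scoped InnerProductSpace ComplexOrder Matrix.Norms.L2Operator Topology

namespace Literature.MathematicalPhysics.QuantumLattice

open Literature.Probability.LatticeModels

/-! ### Non-triviality of the local ground-state projections -/

section Nonzero

variable {d L : ℕ} [NeZero L] {κ : Type*} [Fintype κ] [DecidableEq κ] {q : ℕ}

/-- Under the Local-Gap condition in a non-empty configuration space, every local ground-state
projection of a ball is non-zero (the ground cluster of `H_{b_u(r)}` has `dim ker H_{b_u(r)} ≥ 1`
members). MZ13 §4 Definition 5. [cite: MichalakisZwolakCMP2013, §4 Definition 5 (arXiv:1109.1588 p. 8)] -/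
theorem localGroundProj_ne_zero_of_hasLocalGap [Nonempty (TensorIndex (TorusSite d L × κ) q)]
    {Φ : Interaction (TorusSite d L × κ) q} {γloc : ℕ → ℝ} (hloc : HasLocalGap Φ γloc)
    (x : TorusSite d L) (r : ℕ) :
    localGroundProj Φ (cellBall x r : Finset (TorusSite d L × κ)) ≠ 0 := by
  have hpos : 0 < finrank ℂ (localGroundSpace Φ (cellBall x r : Finset (TorusSite d L × κ))) :=
    (hloc x r).pos
  obtain ⟨v, hv⟩ := Module.finrank_pos_iff_exists_ne_zero.mp hpos
  intro hP
  have h1 := projMatrix_map_mulVec_of_mem (localGroundSpace Φ (cellBall x r)) v.2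
  change localGroundProj Φ (cellBall x r) *ᵥ (v : TensorIndex (TorusSite d L × κ) q → ℂ) = v at h1
  rw [hP, zero_mulVec] at h1
  exact hv (Subtype.ext h1.symm)

end Nonzero

/-! ### Uniform constants -/

section Constants

/-- The index set of the Local-TQO range in the Lemma 3 sum: `{i ≤ L | 2i < L} = {0, …, (L−1)/2}`
for `L ≥ 1`. [folklore] -/
theorem filter_two_mul_lt_eq_range {L : ℕ} (hL : 1 ≤ L) :
    (range (L + 1)).filter (fun i => 2 * i < L) = range ((L - 1) / 2 + 1) := by
  ext i
  simp only [mem_filter, mem_range]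
  omega

/-- The complementary index set: `{i ≤ L | ¬ 2i < L} = {i ≤ L | (L−1)/2 < i}` for `L ≥ 1`.
[folklore] -/
theorem filter_not_two_mul_lt_eq {L : ℕ} (hL : 1 ≤ L) :
    (range (L + 1)).filter (fun i => ¬ 2 * i < L) = (range (L + 1)).filter (fun i => (L - 1) / 2 < i) := by
  ext i
  simp only [mem_filter, mem_range]
  omega

/-- **The Lemma 3 majorant.** For non-negative fast-decaying `φ`, `Δ` and every `P` there is
`Gc ≥ 0` with `Σ_{i ≤ L} φ i g_L(i) ≤ Gc / (L+1)^P` for all `L ≥ 1`, where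
`g_L(i) = Δ((L−1)/2 − i)` for `2i < L` and `1` otherwise (convolution part by
`sum_mul_sub_le_of_pow_bound`, wrapping part by the tail bound). MZ13 Lemma 3 with §7:
"`L^d max{Δ₀(L*), f₀(L*)}`" decays rapidly. [cite: MichalakisZwolakCMP2013, §5 Lemma 3 and §7 (arXiv:1109.1588 pp. 12, 15)] -/
theorem exists_lemma3_majorant {φ Δ : ℕ → ℝ} (hφ : HasFastDecay φ)
    (hΔ : HasFastDecay Δ) (hΔ0 : ∀ i, 0 ≤ Δ i) (P : ℕ) :
    ∃ Gc : ℝ, 0 ≤ Gc ∧ ∀ L : ℕ, 1 ≤ L →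
      ∑ i ∈ range (L + 1), φ i * (if 2 * i < L then Δ ((L - 1) / 2 - i) else 1) ≤
        Gc / ((L : ℝ) + 1) ^ P := by
  obtain ⟨A, hA, hφA⟩ := hφ.exists_pow_bound' (P + 2)
  obtain ⟨B, hB, hΔB⟩ := hΔ.exists_pow_bound' (P + 1)
  refine ⟨(A * B + 2 * A) * 4 ^ P, by positivity, fun L hL => ?_⟩
  set M : ℕ := (L - 1) / 2 with hM
  have hM1 : (0 : ℝ) < (M : ℝ) + 1 := by positivity
  -- split the sum
  rw [← sum_filter_add_sum_filter_not (range (L + 1)) (fun i => 2 * i < L)]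
  have hA' : ∀ i, φ i ≤ A / ((i : ℝ) + 1) ^ (P + 1) := fun i => (hφA i).trans (by
    have hi : (1 : ℝ) ≤ (i : ℝ) + 1 := by linarith [(Nat.cast_nonneg i : (0 : ℝ) ≤ i)]
    exact div_le_div_of_nonneg_left hA (by positivity) (pow_le_pow_right₀ hi (by omega)))
  have h1 : ∑ i ∈ (range (L + 1)).filter (fun i => 2 * i < L),
      φ i * (if 2 * i < L then Δ ((L - 1) / 2 - i) else 1) ≤ A * B / ((M : ℝ) + 1) ^ P := by
    calc ∑ i ∈ (range (L + 1)).filter (fun i => 2 * i < L),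
          φ i * (if 2 * i < L then Δ ((L - 1) / 2 - i) else 1)
        = ∑ i ∈ (range (L + 1)).filter (fun i => 2 * i < L), φ i * Δ (M - i) :=
          sum_congr rfl fun i hi => by rw [if_pos (mem_filter.mp hi).2]
      _ = ∑ i ∈ range (M + 1), φ i * Δ (M - i) := by rw [filter_two_mul_lt_eq_range hL]
      _ ≤ A * B / ((M : ℝ) + 1) ^ P := sum_mul_sub_le_of_pow_bound hA hB hΔ0 hA' hΔB M
  have h2 : ∑ i ∈ (range (L + 1)).filter (fun i => ¬ 2 * i < L),
      φ i * (if 2 * i < L then Δ ((L - 1) / 2 - i) else 1) ≤ 2 * A / ((M : ℝ) + 1) ^ P := by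
    calc ∑ i ∈ (range (L + 1)).filter (fun i => ¬ 2 * i < L),
          φ i * (if 2 * i < L then Δ ((L - 1) / 2 - i) else 1)
        = ∑ i ∈ (range (L + 1)).filter (fun i => M < i), φ i := by
          rw [filter_not_two_mul_lt_eq hL]
          refine sum_congr rfl fun i hi => ?_
          have : ¬ 2 * i < L := by have := (mem_filter.mp hi).2; omega
          rw [if_neg this, mul_one]
      _ ≤ 2 * A / ((M : ℝ) + 1) ^ P := sum_filter_lt_le_of_pow_bound hA hφA M (L + 1)
  have h3 : 1 / ((M : ℝ) + 1) ^ P ≤ 4 ^ P / ((L : ℝ) + 1) ^ P := one_div_half_pred_succ_pow_le L P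
  calc _ ≤ A * B / ((M : ℝ) + 1) ^ P + 2 * A / ((M : ℝ) + 1) ^ P := add_le_add h1 h2
    _ = (A * B + 2 * A) * (1 / ((M : ℝ) + 1) ^ P) := by ring
    _ ≤ (A * B + 2 * A) * (4 ^ P / ((L : ℝ) + 1) ^ P) :=
        mul_le_mul_of_nonneg_left h3 (by positivity)
    _ = (A * B + 2 * A) * 4 ^ P / ((L : ℝ) + 1) ^ P := by ring

/-- **The tail majorant**: `Σ_{i<R, j/2 < i} φ i ≤ Kτ / (j+1)^p` uniformly in `R`.
[folklore] -/
theorem exists_tail_majorant {φ : ℕ → ℝ} (hφ : HasFastDecay φ) (p : ℕ) :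
    ∃ Kτ : ℝ, 0 ≤ Kτ ∧ ∀ j R : ℕ,
      ∑ i ∈ (range R).filter (fun i => j / 2 < i), φ i ≤ Kτ / ((j : ℝ) + 1) ^ p := by
  obtain ⟨C, hC, h⟩ := hφ.exists_pow_bound' (p + 2)
  refine ⟨2 * C * 2 ^ p, by positivity, fun j R => ?_⟩
  calc ∑ i ∈ (range R).filter (fun i => j / 2 < i), φ i ≤ 2 * C / (((j / 2 : ℕ) : ℝ) + 1) ^ p :=
        sum_filter_lt_le_of_pow_bound hC h (j / 2) R
    _ = 2 * C * (1 / (((j / 2 : ℕ) : ℝ) + 1) ^ p) := by ring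
    _ ≤ 2 * C * (2 ^ p / ((j : ℝ) + 1) ^ p) :=
        mul_le_mul_of_nonneg_left (one_div_half_succ_pow_le j p) (by positivity)
    _ = 2 * C * 2 ^ p / ((j : ℝ) + 1) ^ p := by ring

/-- **The LTQO majorant**: `√(2 Δ(j − j/2)) ≤ Kσ / (j+1)^p` for non-negative fast-decaying `Δ`.
[folklore] -/
theorem exists_sqrt_majorant {Δ : ℕ → ℝ} (hΔ : HasFastDecay Δ) (p : ℕ) :
    ∃ Kσ : ℝ, 0 ≤ Kσ ∧ ∀ j : ℕ, Real.sqrt (2 * Δ (j - j / 2)) ≤ Kσ / ((j : ℝ) + 1) ^ p := by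
  obtain ⟨C, hC, h⟩ := hΔ.exists_pow_bound' (2 * p)
  refine ⟨Real.sqrt (2 * C) * 2 ^ p, by positivity, fun j => ?_⟩
  calc Real.sqrt (2 * Δ (j - j / 2)) ≤ Real.sqrt (2 * C) / (((j - j / 2 : ℕ) : ℝ) + 1) ^ p :=
        sqrt_le_of_pow_bound hC (by norm_num) h (j - j / 2)
    _ = Real.sqrt (2 * C) * (1 / (((j - j / 2 : ℕ) : ℝ) + 1) ^ p) := by ring
    _ ≤ Real.sqrt (2 * C) * (2 ^ p / ((j : ℝ) + 1) ^ p) :=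
        mul_le_mul_of_nonneg_left (one_div_sub_half_succ_pow_le j p) (Real.sqrt_nonneg _)
    _ = Real.sqrt (2 * C) * 2 ^ p / ((j : ℝ) + 1) ^ p := by ring

/-- **The total-mass majorant**: `Σ_{i<R} φ i ≤ Fb` uniformly in `R`. [folklore] -/
theorem exists_sum_majorant {φ : ℕ → ℝ} (hφ : HasFastDecay φ) :
    ∃ Fb : ℝ, 0 ≤ Fb ∧ ∀ R : ℕ, ∑ i ∈ range R, φ i ≤ Fb := by
  obtain ⟨C, hC, h⟩ := hφ.exists_pow_bound' 2
  exact ⟨2 * C, by positivity, fun R => sum_range_le_of_sq_bound hC h R⟩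

/-- `Σ_{j<L} (j+2)^a · (K/(j+1)^{a+2}) ≤ 2^a · 2K`. [folklore] -/
theorem sum_succ_succ_pow_mul_le {K : ℝ} (hK : 0 ≤ K) (a L : ℕ) :
    ∑ j ∈ range L, ((j : ℝ) + 2) ^ a * (K / ((j : ℝ) + 1) ^ (a + 2)) ≤ 2 ^ a * (2 * K) := by
  have hkey : ∀ j : ℕ, ((j : ℝ) + 2) ^ a ≤ 2 ^ a * ((j : ℝ) + 1) ^ a := by
    intro j
    rw [← mul_pow]
    exact pow_le_pow_left₀ (by positivity) (by linarith) a
  calc ∑ j ∈ range L, ((j : ℝ) + 2) ^ a * (K / ((j : ℝ) + 1) ^ (a + 2))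
      ≤ ∑ j ∈ range L, 2 ^ a * (((j : ℝ) + 1) ^ a * (K / ((j : ℝ) + 1) ^ (a + 2))) :=
        sum_le_sum fun j _ => by
          rw [← mul_assoc]
          exact mul_le_mul_of_nonneg_right (hkey j) (by positivity)
    _ = 2 ^ a * ∑ j ∈ range L, ((j : ℝ) + 1) ^ a * (K / ((j : ℝ) + 1) ^ (a + 2)) := by
        rw [mul_sum]
    _ ≤ 2 ^ a * (2 * K) := mul_le_mul_of_nonneg_left (sum_pow_mul_pow_bound_le hK a L) (by positivity)

/-- **Uniformity of the relative-boundedness constant** (MZ13 Proposition 2, remark (ii) on p. 15: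
"for fast enough decay of `w(r)` … `c` is a constant depending only on the dimension `d` of the
lattice and the decay rate of `γ(r_k)` and `w(r)`"). With the profile of
`exists_package_of_rotated_decomposition` — `w_0 = 2Fb`, `w_{j+1} = 4G + 8τ_j + 4Fb σ_j` for
`2j < L`, `0` beyond — a local gap `γloc j ≥ c₀/(j+1)^{p₀}`, and majorants
`G (L+1)^{d+p₀+1} ≤ Gc`, `τ_j (j+1)^{d+p₀+2} ≤ Kτ`, `σ_j (j+1)^{d+p₀+2} ≤ Kσ`, the constant
`c_L = Σ_{j ≤ L} (2j+1)^d w_j/γloc j` is at most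
`c_* = (2^d/c₀)(2Fb + 4Gc + 2^{d+p₀}(16Kτ + 8Fb Kσ))`, independently of `L`.
[cite: MichalakisZwolakCMP2013, §6 Prop. 2 and remark (ii) (arXiv:1109.1588 pp. 13, 15)] -/
theorem relative_constant_le {L d p₀ : ℕ} {c₀ Fb G Gc Kτ Kσ : ℝ} {γloc τ σ : ℕ → ℝ}
    (hc₀ : 0 < c₀) (hγloc : ∀ j : ℕ, c₀ / ((j : ℝ) + 1) ^ p₀ ≤ γloc j) (hFb : 0 ≤ Fb) (hG : 0 ≤ G)
    (hτ0 : ∀ j, 0 ≤ τ j) (hσ0 : ∀ j, 0 ≤ σ j) (hKτ : 0 ≤ Kτ) (hKσ : 0 ≤ Kσ)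
    (hGL : G * ((L : ℝ) + 1) ^ (d + p₀ + 1) ≤ Gc)
    (hτ : ∀ j : ℕ, τ j * ((j : ℝ) + 1) ^ (d + p₀ + 2) ≤ Kτ)
    (hσ : ∀ j : ℕ, σ j * ((j : ℝ) + 1) ^ (d + p₀ + 2) ≤ Kσ) :
    ∑ j ∈ range (L + 1), (2 * (j : ℝ) + 1) ^ d *
        (if j = 0 then 2 * Fb
          else if 2 * (j - 1) < L then 4 * G + 8 * τ (j - 1) + 4 * Fb * σ (j - 1) else 0) /
        γloc j ≤
      (2 : ℝ) ^ d / c₀ * (2 * Fb + 4 * Gc + (2 : ℝ) ^ (d + p₀) * (16 * Kτ + 8 * Fb * Kσ)) := by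
  set a : ℕ := d + p₀ with ha
  set wc : ℕ → ℝ := fun j => if j = 0 then 2 * Fb
      else if 2 * (j - 1) < L then 4 * G + 8 * τ (j - 1) + 4 * Fb * σ (j - 1) else 0 with hwc
  have hwc0 : ∀ j, 0 ≤ wc j := by
    intro j; simp only [hwc]; split_ifs
    · positivity
    · have := hτ0 (j - 1); have := hσ0 (j - 1); positivity
    · exact le_rfl
  have hγpos : ∀ j, 0 < γloc j := fun j => lt_of_lt_of_le (by positivity) (hγloc j)
  have hGc0 : 0 ≤ Gc := le_trans (by positivity) hGL
  -- Step 1: termwise comparison with `(2^d/c₀) (j+1)^a wc j`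
  have hterm : ∀ j : ℕ, (2 * (j : ℝ) + 1) ^ d * wc j / γloc j ≤
      (2 : ℝ) ^ d / c₀ * (((j : ℝ) + 1) ^ a * wc j) := by
    intro j
    have hj1 : (0 : ℝ) < (j : ℝ) + 1 := by positivity
    have h1 : (2 * (j : ℝ) + 1) ^ d ≤ 2 ^ d * ((j : ℝ) + 1) ^ d := by
      rw [← mul_pow]; exact pow_le_pow_left₀ (by positivity) (by linarith) d
    have h2 : 1 / γloc j ≤ ((j : ℝ) + 1) ^ p₀ / c₀ := by
      rw [div_le_div_iff₀ (hγpos j) hc₀, one_mul]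
      have := hγloc j
      rw [div_le_iff₀ (pow_pos hj1 p₀)] at this
      linarith
    calc (2 * (j : ℝ) + 1) ^ d * wc j / γloc j
        = (2 * (j : ℝ) + 1) ^ d * wc j * (1 / γloc j) := by ring
      _ ≤ 2 ^ d * ((j : ℝ) + 1) ^ d * wc j * (((j : ℝ) + 1) ^ p₀ / c₀) := by
          apply mul_le_mul _ h2 (le_of_lt (one_div_pos.mpr (hγpos j)))
            (mul_nonneg (by positivity) (hwc0 j))
          exact mul_le_mul_of_nonneg_right h1 (hwc0 j)
      _ = (2 : ℝ) ^ d / c₀ * (((j : ℝ) + 1) ^ a * wc j) := by rw [ha, pow_add]; ring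
  -- Step 2: the weighted sum of the profile
  have hprof : ∑ j ∈ range (L + 1), ((j : ℝ) + 1) ^ a * wc j ≤
      2 * Fb + 4 * Gc + (2 : ℝ) ^ a * (16 * Kτ + 8 * Fb * Kσ) := by
    rw [sum_range_succ']
    have hw0 : ((((0 : ℕ) : ℝ) + 1) ^ a * wc 0) = 2 * Fb := by simp [hwc]
    rw [hw0]
    -- the shifted terms
    have hshift : ∀ j ∈ range L, (((j + 1 : ℕ) : ℝ) + 1) ^ a * wc (j + 1) ≤
        ((L : ℝ) + 1) ^ a * (4 * G) + ((j : ℝ) + 2) ^ a * (8 * (Kτ / ((j : ℝ) + 1) ^ (a + 2))) +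
          ((j : ℝ) + 2) ^ a * (4 * Fb * (Kσ / ((j : ℝ) + 1) ^ (a + 2))) := by
      intro j hj
      have hjL : j < L := mem_range.mp hj
      have hj1 : (0 : ℝ) < (j : ℝ) + 1 := by positivity
      have hcast : (((j + 1 : ℕ) : ℝ) + 1) = (j : ℝ) + 2 := by push_cast; ring
      rw [hcast]
      have hwle : wc (j + 1) ≤ 4 * G + 8 * τ j + 4 * Fb * σ j := by
        simp only [hwc, Nat.succ_ne_zero, if_false, Nat.add_sub_cancel]
        split_ifs
        · exact le_rfl
        · have := hτ0 j; have := hσ0 j; positivity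
      have hτj : τ j ≤ Kτ / ((j : ℝ) + 1) ^ (a + 2) := by
        rw [le_div_iff₀ (pow_pos hj1 _)]; exact hτ j
      have hσj : σ j ≤ Kσ / ((j : ℝ) + 1) ^ (a + 2) := by
        rw [le_div_iff₀ (pow_pos hj1 _)]; exact hσ j
      have hjL' : ((j : ℝ) + 2) ^ a ≤ ((L : ℝ) + 1) ^ a := by
        refine pow_le_pow_left₀ (by positivity) ?_ a
        have : (j : ℝ) + 1 ≤ L := by exact_mod_cast hjL
        linarith
      calc ((j : ℝ) + 2) ^ a * wc (j + 1) ≤ ((j : ℝ) + 2) ^ a * (4 * G + 8 * τ j + 4 * Fb * σ j) :=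
            mul_le_mul_of_nonneg_left hwle (by positivity)
        _ = ((j : ℝ) + 2) ^ a * (4 * G) + ((j : ℝ) + 2) ^ a * (8 * τ j) +
              ((j : ℝ) + 2) ^ a * (4 * Fb * σ j) := by ring
        _ ≤ ((L : ℝ) + 1) ^ a * (4 * G) + ((j : ℝ) + 2) ^ a * (8 * (Kτ / ((j : ℝ) + 1) ^ (a + 2))) +
              ((j : ℝ) + 2) ^ a * (4 * Fb * (Kσ / ((j : ℝ) + 1) ^ (a + 2))) := by
            gcongr
    calc ∑ j ∈ range L, (((j + 1 : ℕ) : ℝ) + 1) ^ a * wc (j + 1) + 2 * Fb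
        ≤ ∑ j ∈ range L, (((L : ℝ) + 1) ^ a * (4 * G) +
            ((j : ℝ) + 2) ^ a * (8 * (Kτ / ((j : ℝ) + 1) ^ (a + 2))) +
            ((j : ℝ) + 2) ^ a * (4 * Fb * (Kσ / ((j : ℝ) + 1) ^ (a + 2)))) + 2 * Fb := by
          gcongr with j hj
          exact hshift j hj
      _ = (L : ℝ) * (((L : ℝ) + 1) ^ a * (4 * G)) +
            8 * ∑ j ∈ range L, ((j : ℝ) + 2) ^ a * (Kτ / ((j : ℝ) + 1) ^ (a + 2)) +
            4 * Fb * ∑ j ∈ range L, ((j : ℝ) + 2) ^ a * (Kσ / ((j : ℝ) + 1) ^ (a + 2)) + 2 * Fb := by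
          rw [sum_add_distrib, sum_add_distrib, sum_const, card_range, nsmul_eq_mul, mul_sum, mul_sum]
          congr 1; congr 1; congr 1
          · refine sum_congr rfl fun j _ => ?_; ring
          · refine sum_congr rfl fun j _ => ?_; ring
      _ ≤ 4 * Gc + 8 * (2 ^ a * (2 * Kτ)) + 4 * Fb * (2 ^ a * (2 * Kσ)) + 2 * Fb := by
          -- `L (L+1)^a 4G ≤ 4 G (L+1)^{a+1} ≤ 4 Gc`
          have hL1 : (L : ℝ) ≤ (L : ℝ) + 1 := by linarith
          have hA : (L : ℝ) * (((L : ℝ) + 1) ^ a * (4 * G)) ≤ 4 * Gc :=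
            calc (L : ℝ) * (((L : ℝ) + 1) ^ a * (4 * G))
                ≤ ((L : ℝ) + 1) * (((L : ℝ) + 1) ^ a * (4 * G)) :=
                  mul_le_mul_of_nonneg_right hL1 (by positivity)
              _ = 4 * (G * ((L : ℝ) + 1) ^ (a + 1)) := by rw [pow_succ]; ring
              _ ≤ 4 * Gc := by linarith
          have hB : 8 * ∑ j ∈ range L, ((j : ℝ) + 2) ^ a * (Kτ / ((j : ℝ) + 1) ^ (a + 2)) ≤
              8 * (2 ^ a * (2 * Kτ)) :=
            mul_le_mul_of_nonneg_left (sum_succ_succ_pow_mul_le hKτ a L) (by norm_num)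
          have hC : 4 * Fb * ∑ j ∈ range L, ((j : ℝ) + 2) ^ a * (Kσ / ((j : ℝ) + 1) ^ (a + 2)) ≤
              4 * Fb * (2 ^ a * (2 * Kσ)) :=
            mul_le_mul_of_nonneg_left (sum_succ_succ_pow_mul_le hKσ a L) (by positivity)
          linarith
      _ = 2 * Fb + 4 * Gc + (2 : ℝ) ^ a * (16 * Kτ + 8 * Fb * Kσ) := by ring
  -- combine
  calc ∑ j ∈ range (L + 1), (2 * (j : ℝ) + 1) ^ d * wc j / γloc j
      ≤ ∑ j ∈ range (L + 1), (2 : ℝ) ^ d / c₀ * (((j : ℝ) + 1) ^ a * wc j) :=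
        sum_le_sum fun j _ => hterm j
    _ = (2 : ℝ) ^ d / c₀ * ∑ j ∈ range (L + 1), ((j : ℝ) + 1) ^ a * wc j := by rw [mul_sum]
    _ ≤ (2 : ℝ) ^ d / c₀ * (2 * Fb + 4 * Gc + (2 : ℝ) ^ a * (16 * Kτ + 8 * Fb * Kσ)) :=
        mul_le_mul_of_nonneg_left hprof (by positivity)

end Constants

/-! ### The final assembly -/

section CoreA

variable (d q : ℕ) {κ : Type*} [Fintype κ] [DecidableEq κ]

/-- **`michalakis_zwolak` from the spectral-flow core.** The hypothesis `hA` is the analytic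
input still to be formalised (MZ13 Lemma 1 (iv)–(v), Lemma 2 and step 1 of Proposition 1, i.e.
Hastings' spectral flow `U(s)` with `U P₀ U⋆ = P₀(s)` and the Lieb–Robinson quasi-locality of
`U⋆ 𝓕(·) U`, after Bachmann–Michalakis–Nachtergaele–Sims): for the data of the named fact, a size
`L_A` and a non-negative fast-decaying profile `φ` such that for `|ε| ≤ 1`, `L ≥ L_A`,
`s ∈ [0, 1]` with the `γ/2`-gap along `[0, s]`, the rotated Hamiltonian decomposes as
`U⋆ (H₀ + sεV) U = H₀ + Σ_u Σ_{i ≤ L} X u i` into Hermitian terms `X u i` supported in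
`cellBall u i`, commuting (per centre `u`) with `P₀`, of norm `≤ |ε| φ i` (MZ13 pp. 11–12:
"`H'_s := U†(s) H_s U(s) = H₀ + Σ_u X_u`, where `[X_u, P₀] = 0`", "`X_u` … a strength `J`
perturbation with rapid decay"). Everything downstream — Lemma 3, Lemma 4, Proposition 1,
Proposition 2, §7 and the bookkeeping of the named fact — is proved
(`exists_package_of_rotated_decomposition`, `relative_constant_le`,
`hasClusterGap_of_stabilityCore`, `michalakis_zwolak_of_latticeCore`).
[cite: MichalakisZwolakCMP2013, Thm. 1 (arXiv:1109.1588 pp. 6–16)] -/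
theorem michalakis_zwolak_of_coreA
    (hA : ∀ (Φ : (L : ℕ) → Interaction (TorusSite d L × κ) q) (m : ℕ → ℕ) (γ : ℝ) (r₀ : ℕ)
      (Δ γloc : ℕ → ℝ),
      (∀ (L : ℕ) [NeZero L], IsProjectorInteraction (Φ L) ∧ (Φ L).IsLocal) →
      (∀ (L : ℕ) [NeZero L], IsFrustrationFree (Φ L) univ) →
      (∀ (L : ℕ) [NeZero L] (X : Finset (TorusSite d L × κ)), r₀ < torusDiam X → Φ L X = 0) →
      (0 < γ ∧ ∀ (L : ℕ) [NeZero L], (localHamiltonian (Φ L) univ).HasClusterGap (m L) 0 γ) →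
      HasUniformLTQO Φ Δ → HasFastDecay Δ → HasUniformLocalGap Φ γloc →
      (∃ c : ℝ, ∃ p : ℕ, 0 < c ∧ ∀ ℓ : ℕ, c / ((ℓ : ℝ) + 1) ^ p ≤ γloc ℓ) →
      ∀ (r : ℕ) (V : (L : ℕ) → Interaction (TorusSite d L × κ) q),
        (∀ (L : ℕ) [NeZero L], (V L).IsLocal ∧
          (∀ X, r < torusDiam X → V L X = 0) ∧ ∀ X, ‖V L X‖ ≤ 1) →
        ∃ L_A : ℕ, ∃ φ : ℕ → ℝ, HasFastDecay φ ∧ (∀ i, 0 ≤ φ i) ∧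
          ∀ ε : ℝ, |ε| ≤ 1 → ∀ (L : ℕ) [NeZero L], L_A ≤ L → ∀ s ∈ Set.Icc (0 : ℝ) 1,
            (∀ t ∈ Set.Icc (0 : ℝ) s, ∃ ω : ℝ, ω ≤ γ ∧
              (localHamiltonian (Φ L) univ +
                (t : ℂ) • ((ε : ℂ) • localHamiltonian (V L) univ)).HasClusterGap (m L) ω (γ / 2)) →
            ∃ (U : Op (TorusSite d L × κ) q) (X : TorusSite d L → ℕ → Op (TorusSite d L × κ) q),
              U ∈ unitary (Op (TorusSite d L × κ) q) ∧
              star U * (localHamiltonian (Φ L) univ +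
                (s : ℂ) • ((ε : ℂ) • localHamiltonian (V L) univ)) * U =
                localHamiltonian (Φ L) univ + ∑ u, ∑ i ∈ range (L + 1), X u i ∧
              (∀ u i, IsSupportedOn (X u i) (cellBall u i)) ∧
              (∀ u i, (X u i).IsHermitian) ∧
              (∀ u, Commute (∑ i ∈ range (L + 1), X u i) (localGroundProj (Φ L) univ)) ∧
              (∀ u i, ‖X u i‖ ≤ |ε| * φ i)) :
    michalakis_zwolak (κ := κ) d q := by
  refine michalakis_zwolak_of_latticeCore d q ?_
  intro Φ m γ r₀ Δ γloc hproj hff hrange hgap hltqo hΔ hloc hγloc r V hV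
  obtain ⟨L_A, φ, hφ, hφ0, hXA⟩ :=
    hA Φ m γ r₀ Δ γloc hproj hff hrange hgap hltqo hΔ hloc hγloc r V hV
  obtain ⟨c₀, p₀, hc₀, hγloc'⟩ := hγloc
  -- the non-negative LTQO rate
  set Δp : ℕ → ℝ := fun ℓ => max (Δ ℓ) 0 with hΔpdef
  have hΔp0 : ∀ ℓ, 0 ≤ Δp ℓ := fun ℓ => le_max_right _ _
  have hltqop : HasUniformLTQO Φ Δp := hltqo.mono fun ℓ => le_max_left _ _
  have hΔp : HasFastDecay Δp := by
    refine hΔ.trans_abs_le fun ℓ => ?_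
    rw [abs_of_nonneg (hΔp0 ℓ)]
    exact max_le (le_abs_self _) (abs_nonneg _)
  -- constants
  set a : ℕ := d + p₀ with hadef
  obtain ⟨Fb, hFb0, hFb⟩ := exists_sum_majorant hφ
  obtain ⟨Gc, hGc0, hGcL⟩ := exists_lemma3_majorant hφ hΔp hΔp0 (a + 1)
  obtain ⟨Kτ, hKτ0, hKτ⟩ := exists_tail_majorant hφ (a + 2)
  obtain ⟨Kσ, hKσ0, hKσ⟩ := exists_sqrt_majorant hΔp (a + 2)
  set cstar : ℝ := (2 : ℝ) ^ d / c₀ * (2 * Fb + 4 * Gc + (2 : ℝ) ^ (d + p₀) * (16 * Kτ + 8 * Fb * Kσ))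
    with hcstardef
  have hcstar0 : 0 ≤ cstar := by positivity
  have hγpos : ∀ j, 0 < γloc j := fun j => lt_of_lt_of_le (by positivity) (hγloc' j)
  refine ⟨min 1 (1 / (3 * cstar + 3)), by positivity, L_A, fun L => 2 * Gc * (1 / ((L : ℝ) + 1)),
    ?_, ?_⟩
  · -- the splitting decays
    have h := (tendsto_one_div_add_atTop_nhds_zero_nat).const_mul (2 * Gc)
    rw [mul_zero] at h
    exact h
  intro ε hε L _ hL s hs hprev
  have hε1 : |ε| ≤ 1 := hε.le.trans (min_le_left _ _)
  have hεc : |ε| * cstar ≤ 1 / 3 := by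
    have h1 : |ε| < 1 / (3 * cstar + 3) := hε.trans_le (min_le_right _ _)
    have h2 : |ε| * cstar ≤ 1 / (3 * cstar + 3) * cstar :=
      mul_le_mul_of_nonneg_right h1.le hcstar0
    have h3 : 1 / (3 * cstar + 3) * cstar ≤ 1 / 3 := by
      rw [div_mul_eq_mul_div, one_mul, div_le_div_iff₀ (by positivity) (by norm_num)]
      linarith
    exact h2.trans h3
  have hδ0 : 0 ≤ 2 * Gc * (1 / ((L : ℝ) + 1)) := by positivity
  rcases isEmpty_or_nonempty (TensorIndex (TorusSite d L × κ) q) with hemp | hne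
  · -- empty configuration space: all operators vanish
    refine ⟨1, 0, 0, 0, one_mem _, Subsingleton.elim _ _, fun x => ?_, fun x _ => ?_,
      fun x => ?_, ?_⟩
    · have hx : x = 0 := Subsingleton.elim _ _
      subst hx
      simp
    · simp
    · simp
    · rw [norm_zero]; exact hδ0
  -- the spectral-flow data at this volume
  obtain ⟨U, X, hU, hdec, hXs, hXh, hXc, hXn⟩ := hXA ε hε1 L hL s hs hprev
  have hP0 : ∀ (x : TorusSite d L) (r : ℕ),
      localGroundProj (Φ L) (cellBall x r : Finset (TorusSite d L × κ)) ≠ 0 :=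
    fun x r => localGroundProj_ne_zero_of_hasLocalGap (hloc L) x r
  have hL1 : 1 ≤ L := NeZero.one_le
  have hL1r : (0 : ℝ) < (L : ℝ) + 1 := by positivity
  obtain ⟨W, D, e, hid, hWker, hHD, hDn, hWform⟩ :=
    exists_package_of_rotated_decomposition (hproj L).1 (hproj L).2 (hltqop L) hΔp0 (hloc L)
      hγpos hP0 X hdec hXs hXh hXc (abs_nonneg ε) hφ0 hXn
      (G := Gc / ((L : ℝ) + 1) ^ (a + 1)) (Fb := Fb) (τ := fun j => Kτ / ((j : ℝ) + 1) ^ (a + 2))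
      (σ := fun j => Kσ / ((j : ℝ) + 1) ^ (a + 2)) (by positivity) hFb0 (fun j => by positivity)
      (fun j => by positivity) (hGcL L hL1) (hFb (L + 1)) (fun j => hKτ j (L + 1)) (fun j => hKσ j)
  refine ⟨U, W, D, e, hU, hid, fun x => ?_, hWker, fun x _ => hHD x, ?_⟩
  · -- the relative form bound with `β = 1/3`
    have h1 := hWform x
    have hc : (∑ j ∈ range (L + 1), (2 * (j : ℝ) + 1) ^ d *
        (if j = 0 then 2 * Fb
          else if 2 * (j - 1) < L then 4 * (Gc / ((L : ℝ) + 1) ^ (a + 1)) +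
            8 * (Kτ / ((((j - 1 : ℕ)) : ℝ) + 1) ^ (a + 2)) +
            4 * Fb * (Kσ / ((((j - 1 : ℕ)) : ℝ) + 1) ^ (a + 2)) else 0) / γloc j) ≤ cstar := by
      have h := relative_constant_le (L := L) (d := d) (p₀ := p₀) (Gc := Gc)
        (τ := fun j => Kτ / ((j : ℝ) + 1) ^ (a + 2)) (σ := fun j => Kσ / ((j : ℝ) + 1) ^ (a + 2))
        hc₀ hγloc' hFb0 (G := Gc / ((L : ℝ) + 1) ^ (a + 1)) (by positivity)
        (fun j => by positivity) (fun j => by positivity) hKτ0 hKσ0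
        (by rw [hadef, div_mul_cancel₀ _ (pow_ne_zero _ hL1r.ne')])
        (fun j => by rw [hadef, div_mul_cancel₀ _ (pow_ne_zero _ (by positivity))])
        (fun j => by rw [hadef, div_mul_cancel₀ _ (pow_ne_zero _ (by positivity))])
      simpa only [hadef] using h
    have hre0 : 0 ≤ RCLike.re ⟪x, toEuclideanLin (localHamiltonian (Φ L) univ) x⟫_ℂ :=
      re_inner_toEuclideanLin_nonneg_of_posSemidef ((hproj L).1.posSemidef_localHamiltonian univ) x
    have hkey : ‖⟪x, toEuclideanLin W x⟫_ℂ‖ ≤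
        1 / 3 * RCLike.re ⟪x, toEuclideanLin (localHamiltonian (Φ L) univ) x⟫_ℂ := by
      refine h1.trans ?_
      refine mul_le_mul_of_nonneg_right ?_ hre0
      calc |ε| * _ ≤ |ε| * cstar := mul_le_mul_of_nonneg_left hc (abs_nonneg ε)
        _ ≤ 1 / 3 := hεc
    have hre : -‖⟪x, toEuclideanLin W x⟫_ℂ‖ ≤ RCLike.re ⟪x, toEuclideanLin W x⟫_ℂ :=
      (abs_le.mp (RCLike.abs_re_le_norm ⟪x, toEuclideanLin W x⟫_ℂ)).1
    linarith
  · -- the splitting bound `‖D‖ ≤ 2 Gc/(L+1)`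
    have hcard : (Fintype.card (TorusSite d L) : ℝ) ≤ ((L : ℝ) + 1) ^ d := by
      have h1 : Fintype.card (TorusSite d L) = L ^ d := by
        rw [Fintype.card_fun, ZMod.card, Fintype.card_fin]
      rw [h1]
      push_cast
      exact pow_le_pow_left₀ (Nat.cast_nonneg _) (by linarith) d
    have hpow : ((L : ℝ) + 1) ^ d / ((L : ℝ) + 1) ^ (a + 1) ≤ 1 / ((L : ℝ) + 1) := by
      rw [show a + 1 = d + (p₀ + 1) by omega, pow_add, div_mul_eq_div_div,
        div_self (pow_ne_zero _ hL1r.ne')]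
      refine one_div_le_one_div_of_le hL1r ?_
      calc (L : ℝ) + 1 = ((L : ℝ) + 1) ^ 1 := (pow_one _).symm
        _ ≤ ((L : ℝ) + 1) ^ (p₀ + 1) := pow_le_pow_right₀ (by linarith) (by omega)
    calc ‖D‖ ≤ Fintype.card (TorusSite d L) * (2 * |ε| * (Gc / ((L : ℝ) + 1) ^ (a + 1))) := hDn
      _ ≤ ((L : ℝ) + 1) ^ d * (2 * 1 * (Gc / ((L : ℝ) + 1) ^ (a + 1))) := by
          apply mul_le_mul hcard _ (by positivity) (by positivity)
          gcongr
      _ = 2 * Gc * (((L : ℝ) + 1) ^ d / ((L : ℝ) + 1) ^ (a + 1)) := by ring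
      _ ≤ 2 * Gc * (1 / ((L : ℝ) + 1)) := mul_le_mul_of_nonneg_left hpow (by positivity)

end CoreA

end Literature.MathematicalPhysics.QuantumLattice
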